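import Summits.Parity.GeneralizedHardyLittlewood.Theses.LiouvilleShiftedTables
import Summits.Parity.GeneralizedHardyLittlewood.Theses.LiouvilleMAD
import Summits.Parity.GeneralizedHardyLittlewood.Theorems.ElliottHalberstam.Negative.ElliottHalberstamStructure
import Summits.Parity.GeneralizedHardyLittlewood.Theorems.ElliottHalberstam.Negative.ElliottHalberstamCoprime
import Summits.Parity.GeneralizedHardyLittlewood.Theorems.EH.Negative.EHFloor
import Summits.Parity.GeneralizedHardyLittlewood.Theorems.ElliottHalberstam.Negative.ElliottHalberstamFixedResidue
import Literature.NumberTheory.Sieve.LevelOfDistributionProofs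

/-!
# Disproof of `ElliottHalberstamCond` (crux stmt-Parity-14985) — findings

Standing-disprover work file (cdisprove seat `refuter-cdisprove-stmt-Parity-14985-0`, cycle 1,
2026-08-16).  The crux item is the Literature constant ITSELF,
`Literature.NumberTheory.Sieve.LevelOfDistribution.ElliottHalberstam = ∀ θ < 1, PrimesHaveLevel θ`
(the Elliott–Halberstam conjecture, `route_premise` of both conditional routes
`LiouvilleShiftedTables` and `LiouvilleMAD`); it is `rfl`-equal to the route decls
`LiouvilleShiftedTables.ElliottHalberstam` / `LiouvilleMAD.ElliottHalberstam` (item stmt-Parity-14092)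
and `Iff.rfl`-equal to the spelled-out node `EH` (stmt-Parity-11314) — §0.  Those two twins have had
full disprover cycles already; THIS FILE DOES NOT REDO THEM, it indexes what they landed (§1), adds one
new kernel-checked section (§2, the fixed-residue form — LANDED as
`Theorems/ElliottHalberstam/Negative/ElliottHalberstamFixedResidue.lean`, p120236, accepted 2026-08-16) and the attack on the
line handed to this seat (§3, card `light-row-dispersion`, First lemma `AntiConcentration θ`).

VERDICT (cycle 1): NO KILL.  The statement is the named open conjecture, faithfully formalised
(§0 read-back; genuine suprema; no junk instance), open for every `θ ∈ [1/2, 1)` and believed; every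
cheap mutation that WOULD be false is excluded by the statement as written (§1, §2).

## §1 Index of the landed negative knowledge (imported, NOT restated; all apply verbatim to this item)

* `Theorems/ElliottHalberstam/Negative/ElliottHalberstamLoadBearing.lean` (p81447): trivial floor
  `E*(x;q) ≥ 1/2` (`3 ≤ q ≤ 2x`), `Σ_{q≤Q} E* ≥ (Q−2)/2`; `θ < 1` dropped ⇒ false
  (`elliottHalberstam_false_without_ltOne`); exact level `≥ x/(log x)^B` false in the `∀A` shape
  (`not_primesHaveLevelFun_of_ge`, `…_logPower`), sharp level `x` false
  (`not_primesHaveSharpLevel_one`); no power saving below the level (`not_isBigO_sum_primeAPError_rpow`).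
* `…/ElliottHalberstamCoprime.lean` (p81638): sup over ALL classes `a : ZMod q` ⇒ false for every
  `θ > 0` (`primesHaveLevelAllResidues_false`, witness `q = 2`, `a = 0`).
* `…/ElliottHalberstamStructure.lean`: `EH ↔ PrimesHaveLevel 1 ↔ (∀ θ<1, sharp level x^θ) ↔
  (∀ θ ∈ [1/2,1), PrimesHaveLevel θ)`; below `1/2` = the tree's PROVED `BombieriVinogradovStatement_holds`.
* `Theorems/EH/Negative/EHFloor.lean` (crux `EH`): floor `E* ≥ 1` (`2 ≤ q ≤ x+1`), growth lemma
  `not_isBigO_div_log_rpow`, `eh_false_without_thetaLtOne/epsPos`, `eh_false_at_closedEndpoint`,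
  log-level and uniform-power-saving strengthenings refuted.
* Work files `Cruxes/ElliottHalberstam/Disproof.lean` §7 and `Cruxes/EH/Disproof.lean` (why it resists:
  numerics cannot see `(log x)^{-A}` at power level below `x ≈ 10^{93}`; Siegel zeros absorbed by the BV
  division of labour at every `θ < 1`; all Ω-results — Friedlander–Granville 1989, FGHM 1991, FG 1992
  (tree: `FriedlanderGranvilleUniformityBarrier_holds`) — live at `x^{1−o(1)}`; `LargeSieveLevelHalf`
  is a METHOD barrier, not falsity evidence).

## §2 NEW: the fixed-residue form (what the routes actually consume)

Both routes use EH at ONE residue (`−h`, Bombieri's asymptotic sieve for `Λ(n)Λ(n+h)` at level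
`1 − ε₀/2`), and the standing planner question on this crux is a re-bridge on a fixed-residue premise
(Cruxes/ElliottHalberstam/IdeatorMemo3 §0; Cruxes/ElliottHalberstamCond/IdeatorMemo-14985-r1k1 §3).
Kernel-checked and LANDED (`…/Negative/ElliottHalberstamFixedResidue.lean`, p120236; imported here, §2 instantiates it):
`fixedResidueSum h x Q = Σ_{q ≤ Q,(q,h)=1} |ψ(x;q,−h) − x/φ(q)|`;
(a) `PrimesHaveLevel.fixedResidue`, `elliottHalberstamFixedResidue_of_elliottHalberstam`: the crux
IMPLIES the fixed-residue form for every `h` and `θ` (sub-sum at height `y = x`) — a re-bridge only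
weakens the premise; (b) `fixedResidueSum_floor`: for every `h ≥ 1`,
`Σ_{q ≤ x,(q,h)=1} |ψ(x;q,−h) − x/φ(q)| ≥ c(h)·x` eventually (witness moduli `q = h + p₁p₂(1+hk) ∈
((x+h)/2, x]`, `h < p₁ < p₂` primes: `ψ(x;q,−h) = Λ(q−h) = 0` since `q − h = p₁p₂(1+hk)` has two prime
factors, against `x/φ(q) ≥ 1`); (c) hence `not_primesHaveSharpLevelFixedResidue_one` — level `x`
exactly is false EVEN for one class and the single height `y = x` (the endpoint failure is not an
artefact of the suprema), `not_primesHaveLevelFixedResidue_of_one_lt` (`θ > 1`),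
`elliottHalberstamFixedResidue_false_without_ltOne`; and `sharpFixedResidue_of_elliottHalberstam`
(sharp fixed-residue level `x^θ` for every `θ < 1` follows from the crux).  UPSHOT for planners: a
fixed-residue re-bridge (`ElliottHalberstamFixedResidue h`, or the tree's
`HasLevelOfDistribution (shiftedPrimes h) θ` for all `θ < 1`, to which EH transfers by
`hasLevelOfDistribution_shiftedPrimes_of_primesHaveLevel_holds`) is implied by the crux, must keep
the same open quantifier `θ < 1`, and is open for every `θ > 1/2` exactly like the crux (beyond `1/2`
only with well-factorable WEIGHTS at a fixed residue — BFI 1986 Thm 10, level `4/7`, tree named fact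
`bfi_wellFactorable_level = PrimesHaveWellFactorableLevel (4/7)` — whereas with absolute values, as
here and as Bombieri's sieve with Möbius coefficients needs, nothing of power strength beyond `1/2` is
known).

## §3 Line `Sketch` = card `light-row-dispersion` (ideator r1 k2), First lemma `AntiConcentration θ`

(The lead recorded the line DEAD as a line — `Lines/Sketch-dead.md`: 0 `stub_*`, no
`ElliottHalberstamCond_of`, and the card itself files NO composition to the crux ("Transfer: NONE");
so there is no joint-sufficiency question.  What remains is the truth of its one typed stub.)
`AntiConcentration θ := ∀ A > 0, ∃ B > 0, ∃ X₀, ∀ M N ≥ 1, X₀ ≤ MN → ∀ H ⊆ (M,2M], |H| ≤ M/(log MN)^B →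
Σ_{q ∈ (Q,2Q]} max_{(a,q)=1} #{(m,n) ∈ H × (N,2N] : mn ≡ a (q)} ≤ MN/(log MN)^A`, `Q = ⌊(MN)^θ⌋`;
`FirstLemma := ∀ θ ∈ [1/2,1), AntiConcentration θ`.  Attacks this cycle (paper; the ideator's kit jobs
j018311/j018326/j019193 already cover eleven structured families + hill-climbs at `X ≤ 1.6·10⁷`,
ratio to generic `≤ 2.1`, non-increasing in `X`):
* DEGENERATE REGIMES pass: `M < (log X)^B` ⇒ `H = ∅`; single row (`|H| = 1`, `N = X/M`) gives
  `Σ_q (N/q + 1) ≈ 0.7·X/(log X)^B + X^θ` — fine once `B > A`; `θ ≥ 1` is FALSE (each prime `q ∈ (X,2X]`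
  not dividing `m n₀` contributes `≥ 1`, total `≫ X` against `X/(log X)^A`) but excluded by `θ < 1`;
  ceiling/alignment gains (`max_a` of the `+1` terms) are `≤ log X` per modulus heuristically
  (`q·e^{-G} ≥ 1`), total `≪ X^θ log X`.
* NO COUNTING OBSTRUCTION BEYOND `1/2` (so (A) is a genuinely arithmetic claim, as the card says, and
  equally no counting argument proves it): in the pure case `N = 1` a counterexample needs
  `Q' = X^θ/(log X)^A` moduli each with a class holding `t = X^{1−θ}/(log X)^A` elements of `H`,
  `|H| = X/(log X)^B`; such AP-cliques pairwise meet in `≤ X/lcm(q,q') + 1 ≤ 2` points (gcd `< X^{2θ−1}`).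
  Large sieve `Σ_{q≤2Q} q Σ_a (|H ∩ a| − |H|/q)² ≤ (X + 4Q²)|H|`: LHS `≥ Q'·Q·t²/4 ≍ X²(log X)^{-3A}`,
  RHS `≍ X^{1+2θ}(log X)^{-B}`: a contradiction iff `(log X)^{B−3A} ≫ X^{2θ−1}`, i.e. exactly for
  `θ ≤ 1/2` (with `B > 3A + O(1)`), vacuous for every `θ > 1/2`.  `k`-set packing (`Q' t^k ≤ m_k |H|^k`) holds for
  every `k` since `(log X)^{kB−(k+1)A} ≤ X^{(k−1)θ}`; Kővári–Sós–Turán for the `K_{2,3}`-free incidence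
  graph allows `L ≤ |H|²/t² = X^{2θ}(log X)^{2A−2B} ≫ Q'` rich lines.  So a counterexample would be a
  "design beyond `√X`": `X^θ/L^A` blocks of size `X^{1−θ}/L^A`, pairwise intersections `≤ 2`, on a ground
  set of size `X/L^B` — combinatorially unobstructed, arithmetically unknown.
* TWO NATURAL CONSTRUCTIONS KILLED (why the `∃ B` after `∀ A` defeats them): (i) rational lifts of
  bounded height (`a_q ≡ c·d̄`, incl. integer lifts `a_q = c`): `h ∈ H` lies in `D = (log X)^{B−2A}`
  blocks iff `dh − c` has `D` divisors in `(Q,2Q]`; by the Sathe–Selberg / Erdős–Kac large-deviation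
  law (`#{n ≤ X : ω(n) ≥ λ log log X} = X(log X)^{−(λ log λ − λ + 1)+o(1)}`, heuristically the same
  exponent shape for `τ_{(Q,2Q]}` under the divisor-weighted measure) the incidence mass available on
  such `n` is `X(log X)^{-E(B−2A)}` with `E(t) → ∞`, below the required `X(log X)^{-2A}` once
  `B ≫_A 1` — dead; (ii) the two-level multiplicative design (moduli `q = g·u`,
  `g ∼ X^{2θ−1}`, `u ∼ X^{1−θ}`, common lift `a_q = 1`, `H = {1 + g n : n ∈ 𝒩}`) reduces (A) at level
  `θ` to "a set `𝒩 ⊆ [1,Y]` of density `(log)^{-B}` containing a `(log)^{-A}`-fraction of the multiples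
  of most `u ∼ √Y`" — i.e. to the SQUARE-ROOT level, where the large sieve bites
  (`Y²L^{-3A}/4 ≤ 5Y²L^{-B}` fails for `B > 3A + 2`) — dead.  Both deaths use only `B ≫ A`, which the
  statement grants.
* VERDICT on the stub: neither killed nor supported; plausible; any proof must be non-`L²` (card's
  thesis confirmed by the computations above); any disproof must be a beyond-`√X` design of AP-cliques,
  for which no arithmetic source is known (multiplicative structure collapses to the `√` level, (ii)).
  Not pursued further: the line is dead as a line and the stub does not bear on the crux's truth.

## §4 Why the crux resists (one paragraph; details in the twins' files)
A refutation needs `≫ x/(log x)^A` of genuine discrepancy spread over `q ≤ x^{1−ε}`, i.e. a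
positive-density family of moduli of size `x^θ`, `θ < 1`, each with a class off by a `(log x)^{-A}`
fraction of its mass — beyond every known irregularity mechanism (Maier matrices are
`x^{o(1)}`-local in `log(x/q)`); a proof needs to pass the large-sieve `1/2` barrier with absolute
values.  Neither is available; the seat lands what IS decidable (§2) and stops.
-/

namespace Summit.Parity.GeneralizedHardyLittlewood.Cruxes.ElliottHalberstamCond.Disproof

open Filter Asymptotics Finset
open Literature.NumberTheory.Sieve Literature.NumberTheory.Sieve.LevelOfDistribution

/-! ## §0 The crux by name: identities and read-back -/

/-- The crux item's signature is the Literature constant; the route decls are `rfl`-equal to it. -/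
example : Summit.Parity.GeneralizedHardyLittlewood.Theses.LiouvilleShiftedTables.ElliottHalberstam =
    Literature.NumberTheory.Sieve.LevelOfDistribution.ElliottHalberstam := rfl

example : Summit.Parity.GeneralizedHardyLittlewood.Theses.LiouvilleMAD.ElliottHalberstam =
    Literature.NumberTheory.Sieve.LevelOfDistribution.ElliottHalberstam := rfl

/-- … and `Iff.rfl`-equal to the spelled-out node `EH` (stmt-Parity-11314). -/
example : Summit.Parity.GeneralizedHardyLittlewood.Theses.LiouvilleShiftedTables.EH ↔
    Literature.NumberTheory.Sieve.LevelOfDistribution.ElliottHalberstam := Iff.rfl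

/-- Full read-back over Mathlib primitives (`Iff.rfl`): `∀ θ < 1, ∀ A > 0, ∀ ε > 0`,
`Σ_{q ∈ [1,⌊x^{θ−ε}⌋₊]} sup_{y ∈ [1,x]} sup_{a ∈ (ZMod q)ˣ} |Σ_{n ≤ ⌊y⌋₊, n ≡ a (q)} Λ n − y/φ(q)|
=O[atTop] x/(log x)^A` — `q : ℕ`, `x y : ℝ`, real `rpow` in both `x^{θ−ε}` and `(log x)^A`; both
suprema genuine for `x ≥ 1` (`bddAbove_range_primeAPError`; `(ZMod q)ˣ` finite nonempty for `q ≥ 1`),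
junk `sSup ∅ = 0` only for `x < 1`; `n = 0` harmless (`Λ 0 = 0`); `θ ≤ 0` vacuously true
(`PrimesHaveLevel.of_nonpos`), `θ < 1/2` proved (BV), content exactly `θ ∈ [1/2,1)`. -/
example : Literature.NumberTheory.Sieve.LevelOfDistribution.ElliottHalberstam ↔
    ∀ θ : ℝ, θ < 1 → ∀ A : ℝ, 0 < A → ∀ ε : ℝ, 0 < ε →
      (fun x : ℝ => ∑ q ∈ Finset.Icc 1 ⌊x ^ (θ - ε)⌋₊,
        ⨆ y : Set.Icc (1:ℝ) x, ⨆ a : (ZMod q)ˣ,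
          |(∑ n ∈ Finset.range (⌊(y:ℝ)⌋₊ + 1),
              ArithmeticFunction.vonMangoldt.residueClass (a : ZMod q) n) - (y : ℝ) / Nat.totient q|)
        =O[atTop] fun x : ℝ => x / Real.log x ^ A := Iff.rfl

/-! ## §1 The landed negatives apply verbatim (imported; three representative instances) -/

example : Literature.NumberTheory.Sieve.LevelOfDistribution.ElliottHalberstam ↔ PrimesHaveLevel 1 :=
  Summit.Parity.GeneralizedHardyLittlewood.Theorems.ElliottHalberstam.Negative.elliottHalberstam_iff_primesHaveLevel_one

example : ¬ Summit.Parity.GeneralizedHardyLittlewood.Theorems.ElliottHalberstam.Negative.ElliottHalberstamWithoutLtOne :=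
  Summit.Parity.GeneralizedHardyLittlewood.Theorems.ElliottHalberstam.Negative.elliottHalberstam_false_without_ltOne

example : ¬ Summit.Parity.GeneralizedHardyLittlewood.Theorems.ElliottHalberstam.Negative.ElliottHalberstamWithoutCoprime :=
  Summit.Parity.GeneralizedHardyLittlewood.Theorems.ElliottHalberstam.Negative.elliottHalberstam_false_without_coprime

example : ¬ ∀ θ : ℝ, θ ≤ 1 → ∀ A : ℝ, 0 < A →
      (fun x : ℝ => ∑ q ∈ Icc 1 ⌊x ^ θ⌋₊, primeAPError x q) =O[atTop]
        fun x : ℝ => x / Real.log x ^ A :=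
  Summit.Parity.GeneralizedHardyLittlewood.Theorems.EH.Negative.eh_false_at_closedEndpoint

/-! ## §2 NEW — the fixed-residue form (landed: `Negative/ElliottHalberstamFixedResidue.lean`, p120236) -/

section FixedResidue
open Summit.Parity.GeneralizedHardyLittlewood.Theorems.ElliottHalberstam.Negative

/-- (a) The crux implies the fixed-residue form at every shift `h` (sub-sum at height `y = x`). -/
example (hE : Literature.NumberTheory.Sieve.LevelOfDistribution.ElliottHalberstam) (h : ℕ) :
    ElliottHalberstamFixedResidue h :=
  elliottHalberstamFixedResidue_of_elliottHalberstam hE h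

/-- (a') … even with the SHARP level `x^θ` for every `θ < 1`. -/
example (hE : Literature.NumberTheory.Sieve.LevelOfDistribution.ElliottHalberstam) (h : ℕ) {θ : ℝ}
    (hθ : θ < 1) : PrimesHaveSharpLevelFixedResidue h θ :=
  sharpFixedResidue_of_elliottHalberstam hE h hθ

/-- (b) The fixed-residue floor: `Σ_{q ≤ x, (q,h)=1} |ψ(x;q,−h) − x/φ(q)| ≥ c(h)·x` eventually. -/
example {h : ℕ} (hh : 1 ≤ h) :
    ∃ c : ℝ, 0 < c ∧ ∀ᶠ x : ℝ in atTop, c * x ≤ fixedResidueSum h x ⌊x⌋₊ :=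
  fixedResidueSum_floor hh

/-- (c) The endpoint is false in the fixed-residue form too: level `x` exactly fails even for ONE
class `−h` and the single height `y = x` (so not an artefact of the suprema in `E*`). -/
example {h : ℕ} (hh : 1 ≤ h) : ¬ PrimesHaveSharpLevelFixedResidue h 1 :=
  not_primesHaveSharpLevelFixedResidue_one hh

/-- (c') `θ < 1` is load-bearing in the fixed-residue form. -/
example {h : ℕ} (hh : 1 ≤ h) : ¬ ∀ θ : ℝ, PrimesHaveLevelFixedResidue h θ :=
  elliottHalberstamFixedResidue_false_without_ltOne hh

/-- (d) The twin-shift instance the routes care about most (`h = 2`): sharp level `x` at the single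
class `−2` is false, level `x^θ` for every `θ < 1` follows from the crux. -/
example : ¬ PrimesHaveSharpLevelFixedResidue 2 1 := not_primesHaveSharpLevelFixedResidue_one (by norm_num)

end FixedResidue

/-! ## §3 Line `Sketch` / `light-row-dispersion` — see the module docstring (prose record only:
the stub `AntiConcentration θ` is neither killed nor supported; the line is dead as a line). -/

/-! ## -- Targets: none (payload.stuck_stubs = []; no registered stubs on this item). -/

end Summit.Parity.GeneralizedHardyLittlewood.Cruxes.ElliottHalberstamCond.Disproof
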